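import Summits.HodgeConjecture.HodgeConjecture.Theorems.Ring2HypothesesDescentAbsolutePrimitiveMiddleGeneral
import HarnessLib

/-!
# Ring 2 — hypotheses layer, descent axis: ROW b06 AND ITS PARENT NODE ARE "PRIMITIVE ABSOLUTE HODGE CLASSES OF ANY FIXED
# LEFSCHETZ DEFECT `k` ARE ALGEBRAIC" — classes of codimension `q` on `(2q + k)`-folds, for EVERY `k` (modulo (N)+(E)+(c))

HONEST FRAMING (page 1, verbatim the cell's standing line): **research route conditional on HC_CM; not a
corollary; Q11.4-sentence-2 already refuted in dim ≥ 3.** Nothing in this file proves a case of the Hodge conjecture;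
nothing discharges the binder of record b06 `Ring2.Hypotheses.AbsoluteHodgeImpliesAlgebraicAV` or its parent node
`AbsoluteHodgeImpliesAlgebraic` (`Ring2HypothesesDescent.lean` :73 / :66; both OPEN); the binder table's numbers do not
move. `HC_CM` (`Theses.RankFourFaces.CMAbelianHodge`) does not occur in this file; `HC_AV` is not asserted.

Hodge ladder STAGE 3, `BINDER-OWNERS.md` row **b06**, seat `ring2-b06` (gen 72), third file of the gen. The DEFECT of an
`η`-primitive class of degree `2q` on an `N`-fold is `k = N − 2q ≥ 0` (`L_η^{k+1}` kills it; defect `0` = primitive AND middle).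
Gen 71 (row b06) and the first file of this gen (parent node) are the defect-`0` forms. Primitive classes can be moved to ANY
defect inside the primitive world: DOWN in defect by ring2-b02's lift `v(c)` on `X × E` (defect `d ↦ d − 1`; primitive — b02,
absolute Hodge — gen 71, descent — first file of this gen, all without `B(X)`), and UP in defect by the BARE pull-back `pr_X^* c`
to `X × E` (defect `d ↦ d + 1`): §1 `map_fst_mem_primitiveClasses_boxSum_of_sq_eq_zero` — **the pull-back of an η-primitive
class is primitive for the exterior-sum class `pr_X^*η + pr_E^*κ` whenever `κ ∪ κ = 0`** (truncated binomial theorem of gen 71's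
first file: `L_θ^{r+1} pr_X^* c = pr_X^*(η^{r+1} c) + (r+1) · pr_X^*(ηʳ c) ∪ pr_E^* κ`, both terms killed by primitivity once
`r ≥ d + 1`); it is absolute Hodge by (N)+(E) and descends by the slice (ring2-b02's `mem_algebraicClasses_of_map_fst_mem`,
fact-free). Hence, for EVERY natural number `k`:

* §2 `forall_absoluteHodge_primitive_algebraic_of_defect_of_canonical` — granted (N), (E), (c): if on every smooth projective `Y`
  and for every polarisation class `θ` every θ-primitive absolute Hodge class of codimension `q ≥ 2` and defect EXACTLY `k`
  (`2q + k = dim Y`) is algebraic, then every primitive absolute Hodge class of codimension `≥ 2` of EVERY defect is algebraic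
  (inductions `…_of_defect_add` / `…_of_add_defect` in the two directions).
* §3 **`absoluteHodgeImpliesAlgebraic_iff_primitive_defect_of_canonical k`: the PARENT node `↔` "θ-primitive absolute Hodge
  classes of codimension `q ≥ 2` on smooth projective `(2q + k)`-folds are algebraic"**; `k = 0` is the first file's
  primitive-middle form, `k = 1`: primitive classes of `H^{2q}` on `(2q+1)`-folds.
* §4 the ROW-b06 twin **`absoluteHodgeImpliesAlgebraicAV_iff_primitive_defect_of_canonical k`** (abelian varieties are closed
  under `× E`; transport along `A ≅ X` as in AbelianAll XXVIII / gen 71); `k = 0` is gen 71's fourth file.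

HONEST COLUMN. Nothing is discharged; «10 · 0» unchanged; row b06, parent node, `HC_AV` OPEN and NOT asserted; (N), (E)/(G), (c)
are named facts displayed as hypotheses; no definition, no named fact, no sorry. COUNT ONCE: lift/primitivity/slice — ring2-b02;
truncated binomial, absolute Hodge stability — gen 71; defect induction — ab-spread-1 XXVIII. NOT claimed: fixed-CODIMENSION forms.

References (bib keys): Deligne1982HodgeCycles (§2 Ex. 2.1 (c), (d) p. 16), CharlesSchnell2014Notes (Def. 11.2.3, §11.2.2
(11.2.2)–(11.2.3), Cor. 11.2.12, Conj. 11.2.18, Prop. 11.3.11), VoisinHodgeI2002 (§6.2.3 Def. 6.24, Thm. 6.25, Cor. 6.26,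
Rem. 6.27), VoisinHodgeII2003 (§9.2.4 Prop. 9.21), Kleiman1968AlgebraicCycles (§1.4 (1.4.6), Thm. 2.9), KerrPearlstein2011 (§3.1),
BrosnanFangNiePearlstein2009 (§6 Lemma 48), Fulton1998 (§10.1 Cor. 10.1), HatcherAT2002 (§3.2 Thm. 3.11, Thm. 3.15),
MumfordAV1970 (§1), SilvermanAEC2009 (III.3.6). -/

noncomputable section

set_option linter.dupNamespace false

open CategoryTheory AlgebraicGeometry MonoidalCategory CartesianMonoidalCategory
open Literature.AlgebraicTopology.SingularHomology Literature.Geometry.Kaehler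
open Literature.AlgebraicGeometry Literature.AlgebraicGeometry.Motives
open Literature.AlgebraicGeometry.HodgeTheory
open Summit.HodgeConjecture.HodgeConjecture.Theorems
open Summit.HodgeConjecture.HodgeConjecture.Ring2.Binders (map_mem_primitiveClasses primitiveLift_mem_primitiveClasses
  mem_algebraicClasses_of_map_fst_mem)

namespace Summit.HodgeConjecture.HodgeConjecture.Ring2.Hypotheses

/-! ## §1 The bare pull-back of a primitive class is primitive for the exterior-sum class (square-zero second summand) -/

section PullbackPrimitive

variable {X T : SchemeOver ℂ} (η : complexBetti X 2) {κ : complexBetti T 2}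

/-- **`pr_X^* c` is `(pr_X^*η + pr_T^*κ)`-primitive in dimension `n + m` when `c` is `η`-primitive in dimension `n`, `κ ∪ κ = 0`
and `m ≥ 1`** (so the defect goes up by `m`): above the middle `c = 0`; otherwise, with `a + r = n + m`,
`L_θ^{r+1} pr_X^* c = pr_X^*(L_η^{r+1} c) + (r+1) · pr_X^*(L_ηʳ c) ∪ pr_T^* κ` (gen 71's truncated binomial theorem
`lefschetzPowTo_boxSum_succ_map_fst_of_sq_eq_zero`) and both `L_η^{r+1} c`, `L_ηʳ c` vanish since `a + r ≥ n + 1`. The case of use: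
`T = E` an elliptic curve (`H⁴(E(ℂ); ℂ) = 0`). [cite: VoisinHodgeI2002, §6.2.3 Def. 6.24 and Cor. 6.26] [cite: Kleiman1968AlgebraicCycles, §1.4 (1.4.6) and Thm. 2.9]
[cite: HatcherAT2002, §3.2 Thm. 3.11 and Thm. 3.15] -/
theorem map_fst_mem_primitiveClasses_boxSum_of_sq_eq_zero (hκ : cupProduct (rfl : 2 + 2 = 4) κ κ = 0) {n m a : ℕ}
    (hm : 1 ≤ m) {c : complexBetti X a} (hc : c ∈ primitiveClasses η n a) :
    complexBetti.map (fst X T) a c ∈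
      primitiveClasses (complexBetti.map (fst X T) 2 η + complexBetti.map (snd X T) 2 κ) (n + m) a := by
  by_cases ha : n < a
  · rw [hc.1 ha, map_zero]
    exact Submodule.zero_mem _
  · obtain ⟨r, hr⟩ : ∃ r, a + (r + 1) = n + m + 1 := ⟨n + m - a, by omega⟩
    rw [primitiveClasses_eq_ker _ (n + m) (show a ≤ n + m by omega) hr (rfl : a + 2 * (r + 1) = a + 2 * (r + 1)),
      LinearMap.mem_ker,
      lefschetzPowTo_boxSum_succ_map_fst_of_sq_eq_zero η κ hκ r (rfl : a + 2 * r = a + 2 * r) rfl (by omega) c,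
      lefschetzPowTo_eq_zero_of_mem_primitiveClasses hc _ (show n + 1 ≤ a + (r + 1) by omega),
      lefschetzPowTo_eq_zero_of_mem_primitiveClasses hc _ (show n + 1 ≤ a + r by omega), map_zero, map_zero,
      LinearMap.map_zero₂, smul_zero, add_zero]

end PullbackPrimitive

/-! ## §2 Moving a primitive absolute Hodge class to a prescribed defect (modulo (N)+(E)+(c)) -/

section Defect

/-- **DOWN TO DEFECT `k` FROM DEFECT `k + e`** (granted (N), (E), (c)): if every θ-primitive absolute Hodge class of codimension
`q ≥ 2` and defect exactly `k` on every smooth projective variety is algebraic, then so is every η-primitive absolute Hodge class of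
codimension `p ≥ 2` and defect `k + e` — `e` lifts `v(c)` on `X × E` (primitive of one defect less: ring2-b02; absolute Hodge:
gen 71; descent: first file of this gen, `mem_algebraicClasses_of_primitiveLift_mem_of_ne_zero`). The first file's
`mem_algebraicClasses_of_absoluteHodge_primitive_of_forall_primitiveMiddle_general` is the case `k = 0`. The hypothesis is NOT
asserted. [cite: Deligne1982HodgeCycles, §2 Example 2.1 (c), (d) (p. 16)] [cite: VoisinHodgeI2002, §6.2.3 Def. 6.24 and Cor. 6.26]
[cite: Kleiman1968AlgebraicCycles, §1.4 (1.4.6)] [cite: KerrPearlstein2011, §3.1] -/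
theorem forall_absoluteHodge_primitive_algebraic_of_defect_add_of_canonical (hN : chartConjugation_canonical)
    (hex : ∀ ⦃n : ℕ⦄ ⦃X : SchemeOver ℂ⦄, IsSmoothProjective n X →
      ∀ (σ : ℂ ≃+* ℂ) (p : ℕ) (c : complexBetti X (2 * p)), ∃ s, IsConjugateClass σ X (2 * p) c s)
    (h21c : deligne1982_lefschetz_absoluteHodge_iff) (k : ℕ)
    (hk : ∀ ⦃N : ℕ⦄ ⦃Y : SchemeOver ℂ⦄, IsSmoothProjective N Y → ∀ ⦃θ : complexBetti Y 2⦄, IsPolarizationClass N Y θ →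
      ∀ q : ℕ, 2 ≤ q → 2 * q + k = N → ∀ z : complexBetti Y (2 * q), IsAbsoluteHodgeClass N Y q z →
        z ∈ primitiveClasses θ N (2 * q) → z ∈ algebraicClasses Y q) :
    ∀ (e : ℕ) {X : SchemeOver ℂ} {n : ℕ}, IsSmoothProjective n X →
      ∀ {η : complexBetti X 2}, IsPolarizationClass n X η → ∀ {p : ℕ}, 2 ≤ p → 2 * p + (k + e) = n →
        ∀ (c : complexBetti X (2 * p)), IsAbsoluteHodgeClass n X p c →
          c ∈ primitiveClasses η n (2 * p) → c ∈ algebraicClasses X p := by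
  intro e
  induction e with
  | zero =>
    intro X n hX η hη p h2 hn c hc hprim
    exact hk hX hη p h2 (by omega) c hc hprim
  | succ r ih =>
    intro X n hX η hη p h2 hn c hc hprim
    obtain ⟨E, hE1⟩ := exists_abelianVariety_dim_eq_one ℂ
    have hE : IsSmoothProjective E.dim E.X := AbelianVariety.isSmoothProjective_holds
    obtain ⟨κ, hκ⟩ := exists_isPolarizationClass hE
    have hX' : IsSmoothProjective (n + E.dim) (X ⊗ E.X) := IsSmoothProjective.tensor_holds hX hE
    have hz := ih hX' (isPolarizationClass_boxSum hX hE hη hκ) (p := p + 1) (by omega) (by omega) _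
      (isAbsoluteHodgeClass_primitiveLift_of_canonical hN hex h21c hX hη E hκ hc (k + r + 1))
      (primitiveLift_mem_primitiveClasses E η κ hE1 (r := k + r) (by omega) hprim)
    exact mem_algebraicClasses_of_primitiveLift_mem_of_ne_zero hX E hE1 η (ne_zero_of_isPolarizationClass hE hκ (by omega))
      (by exact_mod_cast Nat.succ_ne_zero (k + r)) hz

/-- **UP TO DEFECT `d + e` FROM DEFECT `d`** (granted (N), (E) only): if every θ-primitive absolute Hodge class of codimension
`p ≥ 2` and defect exactly `d + e` on every smooth projective variety is algebraic, then so is every η-primitive absolute Hodge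
class of codimension `p ≥ 2` and defect `d` — `e` bare pull-backs to `X × E` (primitive of one defect more: §1, `κ ∪ κ = 0` on a
curve; absolute Hodge: pull-back stability `absolutePullback_of_canonical`; descent: the slice, ring2-b02's
`mem_algebraicClasses_of_map_fst_mem`). The hypothesis is NOT asserted. [cite: CharlesSchnell2014Notes, §11.2.2 (11.2.2)–(11.2.3) and Prop. 11.3.11 (proof)]
[cite: Deligne1982HodgeCycles, §2 Example 2.1 (d) (p. 16)] [cite: Fulton1998, §10.1 Cor. 10.1] [cite: SilvermanAEC2009, III.3.6] -/
theorem forall_absoluteHodge_primitive_algebraic_of_add_defect_of_canonical (hN : chartConjugation_canonical)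
    (hex : ∀ ⦃n : ℕ⦄ ⦃X : SchemeOver ℂ⦄, IsSmoothProjective n X →
      ∀ (σ : ℂ ≃+* ℂ) (p : ℕ) (c : complexBetti X (2 * p)), ∃ s, IsConjugateClass σ X (2 * p) c s) (d : ℕ) :
    ∀ (e : ℕ), (∀ ⦃N : ℕ⦄ ⦃Y : SchemeOver ℂ⦄, IsSmoothProjective N Y → ∀ ⦃θ : complexBetti Y 2⦄, IsPolarizationClass N Y θ →
        ∀ q : ℕ, 2 ≤ q → 2 * q + (d + e) = N → ∀ z : complexBetti Y (2 * q), IsAbsoluteHodgeClass N Y q z →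
          z ∈ primitiveClasses θ N (2 * q) → z ∈ algebraicClasses Y q) →
      ∀ {X : SchemeOver ℂ} {n : ℕ}, IsSmoothProjective n X →
        ∀ {η : complexBetti X 2}, IsPolarizationClass n X η → ∀ {p : ℕ}, 2 ≤ p → 2 * p + d = n →
          ∀ (c : complexBetti X (2 * p)), IsAbsoluteHodgeClass n X p c →
            c ∈ primitiveClasses η n (2 * p) → c ∈ algebraicClasses X p := by
  intro e
  induction e generalizing d with
  | zero =>
    intro hk X n hX η hη p h2 hn c hc hprim
    exact hk hX hη p h2 (by omega) c hc hprim
  | succ r ih =>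
    intro hk X n hX η hη p h2 hn c hc hprim
    obtain ⟨E, hE1⟩ := exists_abelianVariety_dim_eq_one ℂ
    have hE : IsSmoothProjective E.dim E.X := AbelianVariety.isSmoothProjective_holds
    obtain ⟨κ, hκ⟩ := exists_isPolarizationClass hE
    have hX' : IsSmoothProjective (n + E.dim) (X ⊗ E.X) := IsSmoothProjective.tensor_holds hX hE
    have hκκ : cupProduct (rfl : 2 + 2 = 4) κ κ = 0 := by
      haveI := subsingleton_complexBetti hE (k := 4) (by omega)
      exact Subsingleton.elim _ _
    -- `pr_X^* c`: primitive of defect `d + 1` (§1), absolute Hodge ((N)+(E)); by the induction hypothesis (at defect `d + 1`,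
    -- `(d + 1) + r = d + (r + 1)`) it is algebraic on `X × E`, and the slice descends
    refine mem_algebraicClasses_of_map_fst_mem hX E (ih (d + 1) (fun N Y hY θ hθ q hq hqN ↦ hk hY hθ q hq (by omega)) hX'
      (isPolarizationClass_boxSum hX hE hη hκ) h2 (by omega) _ (absolutePullback_of_canonical hN hex hX' hX (fst X E.X) p c hc)
      (map_fst_mem_primitiveClasses_boxSum_of_sq_eq_zero η hκκ (by omega) hprim))

/-- **EVERY DEFECT FROM ONE DEFECT** (granted (N), (E), (c)): if for ONE `k` every θ-primitive absolute Hodge class of codimension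
`q ≥ 2` on every smooth projective `(2q + k)`-fold (every polarisation class `θ`) is algebraic, then every η-primitive absolute
Hodge class of codimension `p ≥ 2` on every smooth projective variety, of every defect `d`, is algebraic (`d ≥ k`: lift `d − k`
times; `d < k`: pull back `k − d` times). The hypothesis is NOT asserted. [cite: Deligne1982HodgeCycles, §2 Example 2.1 (c), (d) (p. 16)]
[cite: VoisinHodgeI2002, §6.2.3 Def. 6.24, Thm. 6.25 and Cor. 6.26] [cite: KerrPearlstein2011, §3.1] -/
theorem forall_absoluteHodge_primitive_algebraic_of_defect_of_canonical (hN : chartConjugation_canonical)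
    (hex : ∀ ⦃n : ℕ⦄ ⦃X : SchemeOver ℂ⦄, IsSmoothProjective n X →
      ∀ (σ : ℂ ≃+* ℂ) (p : ℕ) (c : complexBetti X (2 * p)), ∃ s, IsConjugateClass σ X (2 * p) c s)
    (h21c : deligne1982_lefschetz_absoluteHodge_iff) (k : ℕ)
    (hk : ∀ ⦃N : ℕ⦄ ⦃Y : SchemeOver ℂ⦄, IsSmoothProjective N Y → ∀ ⦃θ : complexBetti Y 2⦄, IsPolarizationClass N Y θ →
      ∀ q : ℕ, 2 ≤ q → 2 * q + k = N → ∀ z : complexBetti Y (2 * q), IsAbsoluteHodgeClass N Y q z →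
        z ∈ primitiveClasses θ N (2 * q) → z ∈ algebraicClasses Y q)
    (d : ℕ) {X : SchemeOver ℂ} {n : ℕ} (hX : IsSmoothProjective n X) {η : complexBetti X 2} (hη : IsPolarizationClass n X η)
    {p : ℕ} (hp : 2 ≤ p) (hd : 2 * p + d = n) (c : complexBetti X (2 * p)) (hc : IsAbsoluteHodgeClass n X p c)
    (hprim : c ∈ primitiveClasses η n (2 * p)) : c ∈ algebraicClasses X p := by
  by_cases hkd : k ≤ d
  · obtain ⟨e, rfl⟩ := Nat.exists_eq_add_of_le hkd
    exact forall_absoluteHodge_primitive_algebraic_of_defect_add_of_canonical hN hex h21c k hk e hX hη hp hd c hc hprim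
  · obtain ⟨e, rfl⟩ := Nat.exists_eq_add_of_lt (not_le.1 hkd)
    exact forall_absoluteHodge_primitive_algebraic_of_add_defect_of_canonical hN hex d (e + 1)
      (fun N Y hY θ hθ q hq hqN ↦ hk hY hθ q hq (by omega)) hX hη hp hd c hc hprim

end Defect

/-! ## §3 The parent node at a fixed primitive defect `k` (modulo (N)+(E)+(c)) -/

section Parent

/-- **THE PARENT NODE `AbsoluteHodgeImpliesAlgebraic ↔` "for every smooth projective complex `Y`, every polarisation class `θ` and
every `q ≥ 2` with `dim Y = 2q + k`, every θ-PRIMITIVE absolute Hodge class in `H^{2q}(Y(ℂ); ℂ)` is algebraic" — FOR EVERY FIXED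
`k`** (modulo (N)+(E)+(c); no `B(X)`): `k = 0` is the primitive-middle form (first file of this gen), `k = 1` the primitive classes of
`H^{2q}` on `(2q+1)`-folds. `⟹` restriction; `⟸`: gen 71's `absoluteHodgeImpliesAlgebraic_iff_primitive_of_canonical` wants the
primitive absolute Hodge classes of every defect, §2 supplies them. Neither side is asserted. [cite: CharlesSchnell2014Notes, §11.2.5 Conj. 11.2.18 and Cor. 11.2.12]
[cite: Deligne1982HodgeCycles, §2 Example 2.1 (c), (d) (p. 16)] [cite: VoisinHodgeI2002, §6.2.3 Def. 6.24 and Thm. 6.25]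
[cite: KerrPearlstein2011, §3.1] -/
theorem absoluteHodgeImpliesAlgebraic_iff_primitive_defect_of_canonical (hN : chartConjugation_canonical)
    (hex : ∀ ⦃n : ℕ⦄ ⦃X : SchemeOver ℂ⦄, IsSmoothProjective n X →
      ∀ (σ : ℂ ≃+* ℂ) (p : ℕ) (c : complexBetti X (2 * p)), ∃ s, IsConjugateClass σ X (2 * p) c s)
    (h21c : deligne1982_lefschetz_absoluteHodge_iff) (k : ℕ) :
    AbsoluteHodgeImpliesAlgebraic ↔
      ∀ ⦃N : ℕ⦄ ⦃Y : SchemeOver ℂ⦄, IsSmoothProjective N Y → ∀ ⦃θ : complexBetti Y 2⦄, IsPolarizationClass N Y θ →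
        ∀ q : ℕ, 2 ≤ q → 2 * q + k = N → ∀ z : complexBetti Y (2 * q), IsAbsoluteHodgeClass N Y q z →
          z ∈ primitiveClasses θ N (2 * q) → z ∈ algebraicClasses Y q := by
  refine ⟨fun h N Y hY θ _ q _ _ z hz _ ↦ h hY q z hz,
    fun h ↦ (absoluteHodgeImpliesAlgebraic_iff_primitive_of_canonical hN hex h21c).2 ?_⟩
  intro n X hX η hη p hp hpn c hprim hc
  exact forall_absoluteHodge_primitive_algebraic_of_defect_of_canonical hN hex h21c k h (n - 2 * p) hX hη hp (by omega) c hc hprim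

/-- **The parent node at primitive defect `k`, keyed to (N), (G), (c)** ((E) from Grothendieck's comparison fact (G), gen 69's
`exists_isConjugateClass_even_of_grothendieck`). None of (N), (G), (c) is asserted. [cite: CharlesSchnell2014Notes, §11.2.2 (11.2.1)–(11.2.3) and Conj. 11.2.18]
[cite: Deligne1982HodgeCycles, §2 Example 2.1 (c), (d) (p. 16)] -/
theorem absoluteHodgeImpliesAlgebraic_iff_primitive_defect_of_grothendieck (hN : chartConjugation_canonical)
    (hG : grothendieck_comparison_realize_surjective) (h21c : deligne1982_lefschetz_absoluteHodge_iff) (k : ℕ) :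
    AbsoluteHodgeImpliesAlgebraic ↔
      ∀ ⦃N : ℕ⦄ ⦃Y : SchemeOver ℂ⦄, IsSmoothProjective N Y → ∀ ⦃θ : complexBetti Y 2⦄, IsPolarizationClass N Y θ →
        ∀ q : ℕ, 2 ≤ q → 2 * q + k = N → ∀ z : complexBetti Y (2 * q), IsAbsoluteHodgeClass N Y q z →
          z ∈ primitiveClasses θ N (2 * q) → z ∈ algebraicClasses Y q :=
  absoluteHodgeImpliesAlgebraic_iff_primitive_defect_of_canonical hN (exists_isConjugateClass_even_of_grothendieck hG) h21c k

end Parent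

/-! ## §4 Row b06 at a fixed primitive defect `k` (modulo (N)+(E)+(c)) -/

section Row

/-- **ABELIAN, DOWN TO DEFECT `k` FROM DEFECT `k + e`** (granted (N), (E), (c)): the abelian twin of
`forall_absoluteHodge_primitive_algebraic_of_defect_add_of_canonical` — hypothesis and conclusion on varieties isomorphic to
complex abelian varieties (`X ≅ A.X`, `(A × E).X = A.X × E.X`), as in AbelianAll XXVIII / gen 71. The hypothesis is NOT asserted.
[cite: Deligne1982HodgeCycles, §2 Example 2.1 (c), (d) (p. 16)] [cite: VoisinHodgeI2002, §6.2.3 Def. 6.24 and Cor. 6.26]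
[cite: MumfordAV1970, §1] -/
theorem forall_absoluteHodge_primitive_algebraic_abelian_of_defect_add_of_canonical (hN : chartConjugation_canonical)
    (hex : ∀ ⦃n : ℕ⦄ ⦃X : SchemeOver ℂ⦄, IsSmoothProjective n X →
      ∀ (σ : ℂ ≃+* ℂ) (p : ℕ) (c : complexBetti X (2 * p)), ∃ s, IsConjugateClass σ X (2 * p) c s)
    (h21c : deligne1982_lefschetz_absoluteHodge_iff) (k : ℕ)
    (hk : ∀ (B : AbelianVariety ℂ) ⦃θ : complexBetti B.X 2⦄, IsPolarizationClass B.dim B.X θ →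
      ∀ q : ℕ, 2 ≤ q → 2 * q + k = B.dim → ∀ z : complexBetti B.X (2 * q), IsAbsoluteHodgeClass B.dim B.X q z →
        z ∈ primitiveClasses θ B.dim (2 * q) → z ∈ algebraicClasses B.X q) :
    ∀ (e : ℕ) {X : SchemeOver ℂ} {n : ℕ}, IsSmoothProjective n X → ∀ (A : AbelianVariety ℂ), A.dim = n → (A.X ≅ X) →
      ∀ {η : complexBetti X 2}, IsPolarizationClass n X η → ∀ {p : ℕ}, 2 ≤ p → 2 * p + (k + e) = n →
        ∀ (c : complexBetti X (2 * p)), IsAbsoluteHodgeClass n X p c →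
          c ∈ primitiveClasses η n (2 * p) → c ∈ algebraicClasses X p := by
  intro e
  induction e with
  | zero =>
    intro X n hX A hA eA η hη p h2 hn c hc hprim
    subst hA
    have hAX : IsSmoothProjective A.dim A.X := AbelianVariety.isSmoothProjective_holds
    have hz := hk A (hη.map_of_iso hX hAX eA) p h2 (by omega) (complexBetti.map eA.hom (2 * p) c)
      (absolutePullback_of_canonical hN hex hAX hX eA.hom p c hc) (map_mem_primitiveClasses eA.hom hprim)
    exact (mem_algebraicClasses_map_iff_of_iso eA).1 hz
  | succ r ih =>
    intro X n hX A hA eA η hη p h2 hn c hc hprim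
    obtain ⟨E, hE1⟩ := exists_abelianVariety_dim_eq_one ℂ
    have hE : IsSmoothProjective E.dim E.X := AbelianVariety.isSmoothProjective_holds
    obtain ⟨κ, hκ⟩ := exists_isPolarizationClass hE
    have hX' : IsSmoothProjective (n + E.dim) (X ⊗ E.X) := IsSmoothProjective.tensor_holds hX hE
    have hA' : (A.prod E).dim = n + E.dim := by rw [AbelianVariety.dim_prod, hA]
    have hz := ih hX' (A.prod E) hA' (whiskerRightIso eA E.X) (isPolarizationClass_boxSum hX hE hη hκ) (p := p + 1)
      (by omega) (by omega) _ (isAbsoluteHodgeClass_primitiveLift_of_canonical hN hex h21c hX hη E hκ hc (k + r + 1))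
      (primitiveLift_mem_primitiveClasses E η κ hE1 (r := k + r) (by omega) hprim)
    exact mem_algebraicClasses_of_primitiveLift_mem_of_ne_zero hX E hE1 η (ne_zero_of_isPolarizationClass hE hκ (by omega))
      (by exact_mod_cast Nat.succ_ne_zero (k + r)) hz

/-- **ABELIAN, UP TO DEFECT `d + e` FROM DEFECT `d`** (granted (N), (E)): the abelian twin of
`forall_absoluteHodge_primitive_algebraic_of_add_defect_of_canonical` (bare pull-backs to `X × E`, §1, slice descent). The
hypothesis is NOT asserted. [cite: CharlesSchnell2014Notes, §11.2.2 (11.2.2)–(11.2.3) and Prop. 11.3.11 (proof)]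
[cite: Deligne1982HodgeCycles, §2 Example 2.1 (d) (p. 16)] [cite: MumfordAV1970, §1] -/
theorem forall_absoluteHodge_primitive_algebraic_abelian_of_add_defect_of_canonical (hN : chartConjugation_canonical)
    (hex : ∀ ⦃n : ℕ⦄ ⦃X : SchemeOver ℂ⦄, IsSmoothProjective n X →
      ∀ (σ : ℂ ≃+* ℂ) (p : ℕ) (c : complexBetti X (2 * p)), ∃ s, IsConjugateClass σ X (2 * p) c s) (d : ℕ) :
    ∀ (e : ℕ), (∀ (B : AbelianVariety ℂ) ⦃θ : complexBetti B.X 2⦄, IsPolarizationClass B.dim B.X θ →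
        ∀ q : ℕ, 2 ≤ q → 2 * q + (d + e) = B.dim → ∀ z : complexBetti B.X (2 * q), IsAbsoluteHodgeClass B.dim B.X q z →
          z ∈ primitiveClasses θ B.dim (2 * q) → z ∈ algebraicClasses B.X q) →
      ∀ {X : SchemeOver ℂ} {n : ℕ}, IsSmoothProjective n X → ∀ (A : AbelianVariety ℂ), A.dim = n → (A.X ≅ X) →
        ∀ {η : complexBetti X 2}, IsPolarizationClass n X η → ∀ {p : ℕ}, 2 ≤ p → 2 * p + d = n →
          ∀ (c : complexBetti X (2 * p)), IsAbsoluteHodgeClass n X p c →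
            c ∈ primitiveClasses η n (2 * p) → c ∈ algebraicClasses X p := by
  intro e
  induction e generalizing d with
  | zero =>
    intro hk X n hX A hA eA η hη p h2 hn c hc hprim
    subst hA
    have hAX : IsSmoothProjective A.dim A.X := AbelianVariety.isSmoothProjective_holds
    have hz := hk A (hη.map_of_iso hX hAX eA) p h2 (by omega) (complexBetti.map eA.hom (2 * p) c)
      (absolutePullback_of_canonical hN hex hAX hX eA.hom p c hc) (map_mem_primitiveClasses eA.hom hprim)
    exact (mem_algebraicClasses_map_iff_of_iso eA).1 hz
  | succ r ih =>
    intro hk X n hX A hA eA η hη p h2 hn c hc hprim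
    obtain ⟨E, hE1⟩ := exists_abelianVariety_dim_eq_one ℂ
    have hE : IsSmoothProjective E.dim E.X := AbelianVariety.isSmoothProjective_holds
    obtain ⟨κ, hκ⟩ := exists_isPolarizationClass hE
    have hX' : IsSmoothProjective (n + E.dim) (X ⊗ E.X) := IsSmoothProjective.tensor_holds hX hE
    have hA' : (A.prod E).dim = n + E.dim := by rw [AbelianVariety.dim_prod, hA]
    have hκκ : cupProduct (rfl : 2 + 2 = 4) κ κ = 0 := by
      haveI := subsingleton_complexBetti hE (k := 4) (by omega)
      exact Subsingleton.elim _ _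
    refine mem_algebraicClasses_of_map_fst_mem hX E (ih (d + 1) (fun B θ hθ q hq hqB ↦ hk B hθ q hq (by omega)) hX'
      (A.prod E) hA' (whiskerRightIso eA E.X) (isPolarizationClass_boxSum hX hE hη hκ) h2 (by omega) _
      (absolutePullback_of_canonical hN hex hX' hX (fst X E.X) p c hc)
      (map_fst_mem_primitiveClasses_boxSum_of_sq_eq_zero η hκκ (by omega) hprim))

/-- **ROW b06 `↔` "for every complex abelian variety `B`, every polarisation class `θ` and every `q ≥ 2` with `dim B = 2q + k`,
every θ-PRIMITIVE absolute Hodge class in `H^{2q}(B(ℂ); ℂ)` is algebraic" — FOR EVERY FIXED `k`** (modulo (N)+(E)+(c)): `k = 0` is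
gen 71's primitive-middle form of row b06 (`absoluteHodgeImpliesAlgebraicAV_iff_isPolarizationClass_primitiveMiddle_of_canonical`).
`⟸`: gen 71's `absoluteHodgeImpliesAlgebraicAV_iff_primitive_of_canonical` wants the primitive absolute Hodge classes of every
defect `d`; lift `d − k` times or pull back `k − d` times inside abelian varieties. Row b06 is NOT asserted.
[cite: Deligne1982HodgeCycles, §2 Example 2.1 (c), (d) (p. 16)] [cite: VoisinHodgeI2002, §6.2.3 Def. 6.24, Thm. 6.25 and Cor. 6.26]
[cite: BrosnanFangNiePearlstein2009, §6 Lemma 48] [cite: KerrPearlstein2011, §3.3] -/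
theorem absoluteHodgeImpliesAlgebraicAV_iff_primitive_defect_of_canonical (hN : chartConjugation_canonical)
    (hex : ∀ ⦃n : ℕ⦄ ⦃X : SchemeOver ℂ⦄, IsSmoothProjective n X →
      ∀ (σ : ℂ ≃+* ℂ) (p : ℕ) (c : complexBetti X (2 * p)), ∃ s, IsConjugateClass σ X (2 * p) c s)
    (h21c : deligne1982_lefschetz_absoluteHodge_iff) (k : ℕ) :
    AbsoluteHodgeImpliesAlgebraicAV ↔
      ∀ (B : AbelianVariety ℂ) ⦃θ : complexBetti B.X 2⦄, IsPolarizationClass B.dim B.X θ →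
        ∀ q : ℕ, 2 ≤ q → 2 * q + k = B.dim → ∀ z : complexBetti B.X (2 * q), IsAbsoluteHodgeClass B.dim B.X q z →
          z ∈ primitiveClasses θ B.dim (2 * q) → z ∈ algebraicClasses B.X q := by
  refine ⟨fun h B θ _ q _ _ z hz _ ↦ h B q z hz,
    fun h ↦ (absoluteHodgeImpliesAlgebraicAV_iff_primitive_of_canonical hN hex h21c).2 ?_⟩
  intro A η hη p hp h2p c hprim hc
  have hX : IsSmoothProjective A.dim A.X := AbelianVariety.isSmoothProjective_holds
  by_cases hkd : k ≤ A.dim - 2 * p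
  · obtain ⟨e, he⟩ := Nat.exists_eq_add_of_le hkd
    exact forall_absoluteHodge_primitive_algebraic_abelian_of_defect_add_of_canonical hN hex h21c k h e hX A rfl (Iso.refl A.X)
      hη hp (by omega) c hc hprim
  · obtain ⟨e, he⟩ := Nat.exists_eq_add_of_lt (not_le.1 hkd)
    exact forall_absoluteHodge_primitive_algebraic_abelian_of_add_defect_of_canonical hN hex (A.dim - 2 * p) (e + 1)
      (fun B θ hθ q hq hqB ↦ h B hθ q hq (by omega)) hX A rfl (Iso.refl A.X) hη hp (by omega) c hc hprim

/-- **Row b06 at primitive defect `k`, keyed to (N), (G), (c)**. None of (N), (G), (c) is asserted; row b06 is NOT asserted.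
[cite: CharlesSchnell2014Notes, §11.2.2 (11.2.1)–(11.2.3)] [cite: Deligne1982HodgeCycles, §2 Example 2.1 (c), (d) (p. 16)] -/
theorem absoluteHodgeImpliesAlgebraicAV_iff_primitive_defect_of_grothendieck (hN : chartConjugation_canonical)
    (hG : grothendieck_comparison_realize_surjective) (h21c : deligne1982_lefschetz_absoluteHodge_iff) (k : ℕ) :
    AbsoluteHodgeImpliesAlgebraicAV ↔
      ∀ (B : AbelianVariety ℂ) ⦃θ : complexBetti B.X 2⦄, IsPolarizationClass B.dim B.X θ →
        ∀ q : ℕ, 2 ≤ q → 2 * q + k = B.dim → ∀ z : complexBetti B.X (2 * q), IsAbsoluteHodgeClass B.dim B.X q z →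
          z ∈ primitiveClasses θ B.dim (2 * q) → z ∈ algebraicClasses B.X q :=
  absoluteHodgeImpliesAlgebraicAV_iff_primitive_defect_of_canonical hN (exists_isConjugateClass_even_of_grothendieck hG) h21c k

end Row

/-! ## Audit: nothing is decided here

No theorem above concludes `AbsoluteHodgeImpliesAlgebraic`, `AbsoluteHodgeImpliesAlgebraicAV`, `HC_AV` or `HC_CM` outright:
§1 is formal, the rest carries the undischarged hypotheses (N), (E)/(G), (c) (named facts of the tree, displayed, never asserted)
and a defect-`k` hypothesis. Axiom closures: the three standard axioms. -/

#print axioms Summit.HodgeConjecture.HodgeConjecture.Ring2.Hypotheses.absoluteHodgeImpliesAlgebraic_iff_primitive_defect_of_canonical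
#print axioms Summit.HodgeConjecture.HodgeConjecture.Ring2.Hypotheses.absoluteHodgeImpliesAlgebraicAV_iff_primitive_defect_of_canonical

end Summit.HodgeConjecture.HodgeConjecture.Ring2.Hypotheses

end
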